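import Summits.AtomisticToContinuum.FouriersLaw.Theorems.HonestZwanzigFeshbachIdentitiesLaplacePositivity

/-!
# `LatticeLandauDamping.AbelThermodynamicLimit`, line `series-law-at-every-laplace-frequency`:
positivity of the current resolvent form (stub `stub_resolventFormPos`)

Support file for item `stmt-AtomisticToContinuum-14013`. For the open pinned anharmonic chain
`P = pinnedChain ω₂ lam β γ` (all parameters `> 0`), both Langevin baths at `T > 0`, `N ≥ 2` sites and a
Laplace frequency `ν > 0`, the Laplace-transformed current autocorrelation
`F_N(ν) = ∫₀^∞ e^{-νt} ∫ J · (P_t J) dμ_{N,T} dt`, `J = ∑_b j_b` the total bond current, is positive.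

Route: the total current is a nice observable (continuous, `|J| ≤ C e^{ϑH}` for `ϑ = 1/(4T)`), centred
(`μ_{N,T}(J) = 0`, momentum reversal) and non-constant for `N ≥ 2` (it vanishes at the origin and equals
`-(1+β)/2` at an explicit phase point), so the positive definiteness of the Laplace-transformed correlation
matrix `HonestZwanzig.pinnedChain_sum_lap_pos` (with all weights `ξ ≡ 1`) gives `lap_ν(J,J) > 0`, and
`lap_ν(J,J) = F_N(ν) - μ(J)²/ν`-type correction vanishes since `μ_{N,T}(J) = 0`.
-/

noncomputable section

open MeasureTheory ProbabilityTheory Filter Topology Set Function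
open scoped NNReal ENNReal
open Literature.MathematicalPhysics.KineticTheory.HeatConduction
open Literature.MathematicalPhysics.KineticTheory OscillatorChain
open Summit.AtomisticToContinuum.FouriersLaw.Theorems.SubdiffusiveBondHeat
open Summit.AtomisticToContinuum.FouriersLaw.Theorems.OddSectorIrreversibility
open Summit.AtomisticToContinuum.FouriersLaw.Theorems.HonestZwanzig

namespace Summit.AtomisticToContinuum.FouriersLaw.Theorems.AbelThermodynamicLimit.SeriesLawAtEveryLaplaceFrequency

variable {N : ℕ}

/-! ### The total current at two phase points -/

/-- The total bond current vanishes at the origin of phase space (all momenta vanish). [folklore] -/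
theorem sum_bondCurrent_zero (ω₂ lam β γ : ℝ) (N : ℕ) :
    ∑ i : Fin N, (pinnedChain ω₂ lam β γ).bondCurrent N i (0 : PhaseSpace N) = 0 := by
  refine Finset.sum_eq_zero fun i _ => ?_
  unfold OscillatorChain.bondCurrent
  refine Finset.sum_eq_zero fun j _ => ?_
  split_ifs <;> simp

/-- At the phase point `q = -δ_0`, `p = δ_0` (`N ≥ 2`) only the bond `(0,1)` carries current, and the total
bond current equals `-V'(1)/2 = -(1+β)/2`. [folklore] -/
theorem sum_bondCurrent_testPoint (ω₂ lam β γ : ℝ) (hN : 2 ≤ N) :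
    ∑ i : Fin N, (pinnedChain ω₂ lam β γ).bondCurrent N i
      ((fun k : Fin N => if k.val = 0 then (-1 : ℝ) else 0), fun k : Fin N => if k.val = 0 then (1 : ℝ) else 0) =
      -((1 + β) / 2) := by
  rw [Finset.sum_eq_single ⟨0, by omega⟩]
  · unfold OscillatorChain.bondCurrent
    rw [Finset.sum_eq_single ⟨1, by omega⟩]
    · simp only [zero_add, if_true, one_ne_zero, if_false, pinnedChain_deriv_V]
      ring
    · intro j _ hj
      have hj1 : j.val ≠ 1 := fun h => hj (Fin.ext h)
      simp [hj1]
    · simp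
  · intro i _ hi
    have hi0 : i.val ≠ 0 := fun h => hi (Fin.ext h)
    unfold OscillatorChain.bondCurrent
    refine Finset.sum_eq_zero fun j _ => ?_
    split_ifs with hj
    · have hj0 : j.val ≠ 0 := by omega
      simp [hi0, hj0]
    · rfl
  · simp

/-! ### The stub -/

/-- **Stub POS — the current resolvent form is positive.** For `P = pinnedChain ω₂ lam β γ` (all `> 0`),
`T > 0`, `N ≥ 2` and `ν > 0`: `0 < F_N(ν) = ∫₀^∞ e^{-νt} ∫ J·(P_t J) dμ_{N,T} dt`, `J = ∑_b j_b`. The total current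
is nice (`|J| ≤ C e^{H/(4T)}`), centred (`μ_{N,T}(J) = 0`) and non-constant (`sum_bondCurrent_zero`,
`sum_bondCurrent_testPoint`), so `HonestZwanzig.pinnedChain_sum_lap_pos` / `pinnedChain_sum_lap_eq_lap_sum` with
weights `ξ ≡ 1` give `lap_ν(J,J) > 0`, and `lap_ν(J,J) = F_N(ν)` because the subtracted product of means vanishes.
[folklore] -/
theorem stub_resolventFormPos :
    ∀ ω₂ lam β γ : ℝ, 0 < ω₂ → 0 < lam → 0 < β → 0 < γ → ∀ T : ℝ, 0 < T → ∀ N : ℕ, 2 ≤ N → ∀ ν : ℝ, 0 < ν →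
    0 < MeasureTheory.integral (MeasureTheory.volume.restrict (Set.Ioi (0:ℝ))) (fun t : ℝ =>
        Real.exp (-(ν * t)) *
          ∫ z, (∑ i : Fin N, (Literature.MathematicalPhysics.KineticTheory.HeatConduction.pinnedChain ω₂ lam β γ).bondCurrent N i z) *
            (∫ y, (∑ i : Fin N, (Literature.MathematicalPhysics.KineticTheory.HeatConduction.pinnedChain ω₂ lam β γ).bondCurrent N i y) ∂((Literature.MathematicalPhysics.KineticTheory.HeatConduction.pinnedChain ω₂ lam β γ).transitionKernel N T T t.toNNReal z))
            ∂((Literature.MathematicalPhysics.KineticTheory.HeatConduction.pinnedChain ω₂ lam β γ).gibbsMeasure N T)) := by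
  intro ω₂ lam β γ hω hl hβ hγ T hT N hN ν hν
  have hN0 : 0 < N := by omega
  -- the exponent `ϑ = 1/(4T)`
  have hϑ0 : 0 < 1 / (4 * T) := by positivity
  have h2ϑ : 2 * (1 / (4 * T)) < 1 / T := by
    rw [show 2 * (1 / (4 * T)) = 1 / T * (1 / 2) by ring]
    exact mul_lt_of_lt_one_right (by positivity) (by norm_num)
  have hϑ1 : 1 / (4 * T) < 1 / T := by linarith
  -- the bond currents are nice, with a uniform constant
  have he : ∀ x : Fin N, Continuous ((pinnedChain ω₂ lam β γ).bondCurrent N x) := fun x =>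
    pinnedChain_continuous_bondCurrent ω₂ lam β γ N x
  set C : ℝ := N * ((3 + β) / 2) * (2 * Real.exp (1 / (4 * T)) / (1 / (4 * T)) ^ 2) with hC
  have hC0 : 0 ≤ C := by have := hβ.le; positivity
  have heb : ∀ (x : Fin N) (y : PhaseSpace N), |(pinnedChain ω₂ lam β γ).bondCurrent N x y| ≤
      C * Real.exp (1 / (4 * T) * (pinnedChain ω₂ lam β γ).hamiltonian N y) := fun x y => by
    have hH0 := pinnedChain_hamiltonian_nonneg hω.le hl.le hβ.le γ N y
    have hj := pinnedChain_abs_bondCurrent_le hω.le hl.le hβ.le γ N x y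
    have hsq := one_add_sq_le_exp hH0 hϑ0
    have hβ3 : 0 ≤ (N : ℝ) * ((3 + β) / 2) := by have := hβ.le; positivity
    calc |(pinnedChain ω₂ lam β γ).bondCurrent N x y|
        ≤ N * ((3 + β) / 2 * (1 + (pinnedChain ω₂ lam β γ).hamiltonian N y) ^ 2) := hj
      _ = N * ((3 + β) / 2) * (1 + (pinnedChain ω₂ lam β γ).hamiltonian N y) ^ 2 := by ring
      _ ≤ N * ((3 + β) / 2) * (2 * Real.exp (1 / (4 * T)) / (1 / (4 * T)) ^ 2 *
            Real.exp (1 / (4 * T) * (pinnedChain ω₂ lam β γ).hamiltonian N y)) :=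
          mul_le_mul_of_nonneg_left hsq hβ3
      _ = C * Real.exp (1 / (4 * T) * (pinnedChain ω₂ lam β γ).hamiltonian N y) := by rw [hC]; ring
  -- the total current is centred
  have hmean : ∫ z, (∑ x : Fin N, (pinnedChain ω₂ lam β γ).bondCurrent N x z)
      ∂((pinnedChain ω₂ lam β γ).gibbsMeasure N T) = 0 := by
    rw [integral_finsetSum _ fun x _ => pinnedChain_integrable_nice hω hl.le hβ hT hϑ1 (he x) (heb x)]
    exact Finset.sum_eq_zero fun x _ => pinnedChain_integral_bondCurrent_gibbsMeasure ω₂ lam β γ N T x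
  -- the total current is non-constant
  have hne : ∑ x : Fin N, (1 : ℝ) * (pinnedChain ω₂ lam β γ).bondCurrent N x
        ((fun k : Fin N => if k.val = 0 then (-1 : ℝ) else 0), fun k : Fin N => if k.val = 0 then (1 : ℝ) else 0) ≠
      ∑ x : Fin N, (1 : ℝ) * (pinnedChain ω₂ lam β γ).bondCurrent N x (0 : PhaseSpace N) := by
    simp only [one_mul]
    rw [sum_bondCurrent_testPoint ω₂ lam β γ hN, sum_bondCurrent_zero ω₂ lam β γ N]
    have := hβ.le
    intro h
    linarith
  -- positive definiteness of the Laplace-transformed correlation matrix, weights `ξ ≡ 1`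
  have h := pinnedChain_sum_lap_pos hω hl.le hβ hγ hN0 hT hϑ0 h2ϑ he hC0 heb (fun _ => (1 : ℝ)) hne hν
  rw [pinnedChain_sum_lap_eq_lap_sum hω hl.le hβ hγ hN0 hT hϑ0 h2ϑ he hC0 heb (fun _ => (1 : ℝ)) hν.le] at h
  simp only [one_mul, hmean, mul_zero, sub_zero] at h
  exact h

end Summit.AtomisticToContinuum.FouriersLaw.Theorems.AbelThermodynamicLimit.SeriesLawAtEveryLaplaceFrequency

end
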